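import Summits.HodgeConjecture.HodgeConjecture.Theorems.Ring2WeilCoverageWeilGramLevel44Principal
import Summits.HodgeConjecture.HodgeConjecture.Theorems.Ring2WeilCoverageWeilGramLevel44TypeElevenTraces
import Summits.HodgeConjecture.HodgeConjecture.Theorems.Ring2WeilCoverageWeilGramLevel44TypeTwoTraces
import Summits.HodgeConjecture.HodgeConjecture.Theorems.Ring2WeilCoverageWeilGramLevel44SurdSevenTraces
import Summits.HodgeConjecture.HodgeConjecture.Theorems.Ring2WeilCoverageRamifiedTypesLevels33and44
import Summits.HodgeConjecture.HodgeConjecture.Theorems.Ring2WeilCoverageRamifiedTypesLevel44PrimeTwo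
import Summits.HodgeConjecture.HodgeConjecture.Theorems.Ring2WeilCoverageSurdTypesLevel44
import Summits.HodgeConjecture.HodgeConjecture.Theorems.Ring2WeilNormObstructionDescentCensus
import HarnessLib

/-!
# Weil-type family coverage — THE COMPONENTS OF THE WEIL-TYPE `ℤ[ζ₄₄]`-TENFOLDS, VIII: the TYPES on the NO row
# `(44, ℚ(√−11))` — `𝔮₁₁` (degree `11`): determinant `-1814078464`, SPLIT (row W10.11.1); `𝔮₂` (degree `32`):
# determinant `-5277319168`, class `[−2]`, **NON-SPLIT component `(5, ℚ(√−11), 2)`**; `(2 + √11)` (degree `7⁵`):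
# determinant `-2771746976768`, class `[−7]`, **NON-SPLIT component `(5, ℚ(√−11), 7)`** — for EVERY `ℚ(√−11)`-balanced CM type

research route conditional on HC_CM; not a corollary; Q11.4-sentence-2 already refuted in dim ≥ 3.

Ring 2, WEIL-TYPE FAMILY-COVERAGE CENSUS (`HOME/WEIL-FAMILY-COVERAGE.md` `## b01`, block b01.41 (B)/(B′)/(C) at `g = 10`:
«`(44, √−11)`: `𝔮₁₁` degree `11 ≡ 1` SPLIT; type B `𝔮₂` degree `32 ≡ 2`, `T = {2,11}`: `(5, ℚ(√−11), 2)` NON-SPLIT;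
`2 + √11`: `16807 ≡ 7`, `T = {7,11}`: `(5, ℚ(√−11), 7)` NON-SPLIT», S-pencil there), part 134 of the
`Ring2WeilCoverage*` series; continues parts 130–133.  Parts 50, 52a and 54e (`Ring2WeilCoverageRamifiedTypesLevels33and44`,
`…RamifiedTypesLevel44PrimeTwo`, `…SurdTypesLevel44`) proved that EVERY `ℚ(√−11)`-balanced CM type `Φ` of `ℚ(ζ₄₄)`
carries `Φ`-positive divisors of all three types.  Here, for each type: **invariance** of `det a` over the type (part 82
+ THEOREM L (i) at `44`), the **CENSUS FORM** (existence + determinant), and the **CLASS**: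

* §1 `𝔮₁₁` (`π₁₁ = ζ⁴¹(1 − ζ⁴)(1 − ζ²)`): `[-1814078464] = [−1]·[42592²] = splitDiscriminantClass 5 11` — SPLIT
  (census W10.11.1; the class theorem is part 126's `WeilGramLevel33Types.mk0_det_typeEleven_sqrtNegEleven` — the same number).
* §2 `𝔮₂` (`π₂ = ζ³⁸(1 − ζ¹¹)(1 − ζ)`): `[-5277319168] = [−2] ≠ splitDiscriminantClass 5 11` (`2 ∉ Nm(ℚ(√−11)ˣ)`, ring2-b02's
  `two_not_mem_norm_eleven`; the class theorem is part 126's `WeilGramLevel33Types.mk0_det_surdTwo_sqrtNegEleven` — the same number):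
  **the type-`𝔮₂` polarised Weil-type `ℤ[ζ₄₄]`-CM tenfolds lie on the NON-SPLIT component `(5, ℚ(√−11), 2)`** (census W10.11.2).
* §3 `(2 + √11)`: `[-2771746976768] = [−7] ≠ splitDiscriminantClass 5 11` (`7 ∉ Nm(ℚ(√−11)ˣ)`, ring2-b02's
  `seven_not_mem_norm_eleven`): **the type-`(2 + √11)` polarised Weil-type `ℤ[ζ₄₄]`-CM tenfolds lie on the NON-SPLIT
  component `(5, ℚ(√−11), 7)`** (census W10.11.7) — each for EVERY one of the 252 `ℚ(√−11)`-balanced CM types, with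
  the right sign `(−1)⁵ det a > 0`.

HONEST FRAMING as parts 127/128; `HC_CM` is used nowhere.  No `def`, no named fact, no `sorry`.

References: [cite: vanGeemen1994HodgeAV, Lemma 5.2 (2)–(4), 5.4 and (5.4.1)]; [cite: Shimura1998, §14.3 Prop. 4–5,
pp. 103–104]; [cite: Serre1973, Ch. III §1]; census b01.41 (B)/(B′)/(C) (seat-derived).
-/

noncomputable section

open Polynomial NumberField Module
open scoped nonZeroDivisors

namespace Summit.HodgeConjecture.Ring2WeilCoverage.WeilGramLevel44Types

open Literature.AlgebraicGeometry.VanGeemen1994 (weilField weilNormResidueGroup)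
open Literature.AlgebraicGeometry.Motives (CMType normUnitsSubgroup)
open Literature.NumberTheory.ComplexMultiplication
open Summit.HodgeConjecture.Ring2WeilCoverage.WeilGramTools
open Summit.HodgeConjecture.Ring2WeilCoverage.WeilGramCMPoint
open Summit.HodgeConjecture.Ring2WeilCoverage.RealUnitNormHalfSystems (complexConj_eq_inv)
open Summit.HodgeConjecture.Ring2WeilCoverage.CyclotomicPrincipalObstruction (complexConj_xi)
open Summit.HodgeConjecture.Ring2WeilCoverage.CyclotomicDifferent (isOfType_one_xi_top xi_ne_zero)
open Summit.HodgeConjecture.HodgeConjecture.Ring2.WeilCoverage (mk_neg_eq_split_of_odd mk_neg_ne_split_of_odd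
  mk_eq_split_of_even mk_ne_split_of_even mem_normUnitsSubgroup_of_sq_add_mul_sq natCast_not_mem_normUnitsSubgroup_of_ramified)
open Summit.HodgeConjecture.HodgeConjecture.Ring2.Hypotheses (splitDiscriminantClass)
open Summit.HodgeConjecture.Ring2WeilCoverage.WeilGramLevel44
open Summit.HodgeConjecture.Ring2WeilCoverage.WeilGramLevel44Principal
open Summit.HodgeConjecture.Ring2WeilCoverage.WeilGramLevel44TypeElevenTraces
open Summit.HodgeConjecture.Ring2WeilCoverage.WeilGramLevel44TypeTwoTraces
open Summit.HodgeConjecture.Ring2WeilCoverage.WeilGramLevel44SurdSevenTraces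
open Summit.HodgeConjecture.Ring2WeilCoverage.CyclotomicUnconditionalSqrtNegEleven (norm_realUnits_pos_fortyFour)
open Summit.HodgeConjecture.Ring2WeilCoverage.RamifiedTypes (isOfType_one_gen_mul_xi complexConj_gen_mul_xi gen_ne_zero)
open Summit.HodgeConjecture.Ring2WeilCoverage.RamifiedTypesLevels33and44 (adm_fortyFour exists_type_fortyFour_sqrt_neg_eleven)
open Summit.HodgeConjecture.Ring2WeilCoverage.RamifiedTypesLevel44PrimeTwo (adm_fortyFourB exists_type_fortyFourB_sqrt_neg_eleven)
open Summit.HodgeConjecture.Ring2WeilCoverage.RealGeneratorTypes (isOfType_one_mul_xi complexConj_mul_xi)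
open Summit.HodgeConjecture.Ring2WeilCoverage.SurdTypesLevel44 (signSet_fortyFour_seven coe_surd_fortyFour exists_type_fortyFour_seven_sqrt_neg_eleven)
open Summit.HodgeConjecture.Ring2WeilNormDescent (seven_not_mem_norm_eleven)
variable {K : Type} [Field K] [NumberField K] {ζ : K}

/-- `𝐞(t) = exp(2πi t/n) ∈ ℂ` (`ZMod.toCircle`). -/
local notation3 (prettyPrint := false) "𝐞 " t:max => ((ZMod.toCircle t : Circle) : ℂ)

/-- the residue set `S_Φ` read at level `44`. -/
local notation3 (prettyPrint := false) "SΦ[" Φ "," z "]" =>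
  (Finset.univ.filter fun t : ZMod 44 => ∃ σ ∈ (Φ : CMType K).1, σ (z : K) = 𝐞 t)

/-! ### §1 Type `𝔮₁₁`: invariance, census form, class SPLIT (row W10.11.1) -/

/-- **For EVERY skew `ζ′` of type 𝔮₁₁ (degree `11`) on `ℤ[ζ_44]` (`IsOfType 1 ζ′ 𝔣₀`, `𝔬𝔣₀ = (π)`, `(𝔬𝔣₀)¹⁰ = (11)`, degree `11`; `ζ′ = u·πξ`,
`u` a real unit of norm `1` by THEOREM L (i) at `44`) the Gram determinant of `(E_ζ′, s₁₁)` in the frame `θ^i` is `-1814078464`**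
(they exist on every `ℚ(√−11)`-balanced `Φ`, part 50): the SPLIT row for `ℚ(√−11)` at `g = 10` (census W10.11.1 `= (5, ℚ(√−11), 1)`); `(−1)⁵ det a > 0`, the right sign for Weil signature `(5,5)` [vG94 5.2 (4)].
research route conditional on HC_CM; not a corollary; Q11.4-sentence-2 already refuted in dim ≥ 3. [cite: vanGeemen1994HodgeAV, Lemma 5.2 (3)–(4) and (5.4.1)] [cite: Shimura1998, §14.3 Prop. 4–5, pp. 103–104] -/
theorem det_realPart_typeEleven_sqrtNegEleven [IsCyclotomicExtension {44} ℚ K] [IsCMField K]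
    (hζ : IsPrimitiveRoot ζ 44) {𝔣₀ : Ideal (𝓞 (maximalRealSubfield K))}
    (h𝔣₀ : 𝔣₀.map (algebraMap (𝓞 (maximalRealSubfield K)) (𝓞 K)) = Ideal.span {hζ.toInteger ^ 41 * (1 - hζ.toInteger ^ 4) * (1 - hζ.toInteger ^ 2)})
    {ζ' : K} (hζ' : IsCMField.complexConj K ζ' = -ζ')
    (hT : CMTypeLattice.IsOfType (1 : (FractionalIdeal (𝓞 K)⁰ K)ˣ) ζ' 𝔣₀)
    {x : Fin 10 → K} (hx : ∀ i, x i = (ζ + ζ⁻¹) ^ (i : ℕ)) {a : Matrix (Fin 10) (Fin 10) ℚ}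
    (ha : ∀ i j, a i j = Algebra.trace ℚ K (ζ' * x i * IsCMField.complexConj K ((1 + 2 * (ζ ^ 4 + ζ ^ 12 + ζ ^ 16 + ζ ^ 20 + ζ ^ 36)) * x j))) :
    a.det = -1814078464 := by
  obtain ⟨ωb, hωb⟩ := exists_basis_thetaPow hζ
  have hx' : ∀ i, x i = (ωb i : K) := fun i => (hx i).trans (hωb i).symm
  have hg : Nat.totient 44 = 2 * (9 + 1) := by decide
  have hsk : IsCMField.complexConj K (ζ ^ 41 * (1 - ζ ^ 4) * (1 - ζ ^ 2) * (ζ ^ 9 * (aeval ζ (derivative (cyclotomic 44 ℚ)))⁻¹)) =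
      -(ζ ^ 41 * (1 - ζ ^ 4) * (1 - ζ ^ 2) * (ζ ^ 9 * (aeval ζ (derivative (cyclotomic 44 ℚ)))⁻¹)) := by
    exact complexConj_gen_mul_xi hζ hg adm_fortyFour
  have h0 : (ζ ^ 41 * (1 - ζ ^ 4) * (1 - ζ ^ 2) * (ζ ^ 9 * (aeval ζ (derivative (cyclotomic 44 ℚ)))⁻¹)) ≠ 0 :=
    mul_ne_zero (by exact gen_ne_zero hζ adm_fortyFour) (xi_ne_zero hζ 9)
  have hT₀ : CMTypeLattice.IsOfType (1 : (FractionalIdeal (𝓞 K)⁰ K)ˣ) (ζ ^ 41 * (1 - ζ ^ 4) * (1 - ζ ^ 2) * (ζ ^ 9 * (aeval ζ (derivative (cyclotomic 44 ℚ)))⁻¹)) 𝔣₀ := by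
    exact isOfType_one_gen_mul_xi hζ 9 ((4, 2, 41) : ℕ × ℕ × ℕ) h𝔣₀
  rw [det_realPart_eq_of_isOfType ωb (complexConj_sqrtNegEleven hζ) hx' (norm_realUnits_pos_fortyFour hζ)
    hsk h0 hζ' hT₀ hT (fun i j => rfl) ha]
  exact det_realPart_piEleven_sqrtNegEleven hζ hx (fun i j => rfl)

open scoped Classical in
/-- **CENSUS FORM** (part 50's existence + the determinant): for every CM type `Φ` of `ℚ(ζ_44)` balanced for `N_K = {7, 13, 17, 19, 21, 29, 35, 39, 41, 43}` (Weil signature `(5,5)`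
for `K_d = ℚ(√−11)`) and the type `𝔣₀` above, `ℂ^Φ/Φ(ℤ[ζ_44])` carries a `Φ`-positive divisor of type `(K; Φ; 𝔣₀)`, and
EVERY such divisor `X_ζ′` has van Geemen Gram determinant `-1814078464` in the real frame `θ^i`: the SPLIT row for `ℚ(√−11)` at `g = 10` (census W10.11.1 `= (5, ℚ(√−11), 1)`).
research route conditional on HC_CM; not a corollary; Q11.4-sentence-2 already refuted in dim ≥ 3. [cite: vanGeemen1994HodgeAV, Lemma 5.2 (3)–(4) and (5.4.1)] [cite: Shimura1998, §14.3 Prop. 4–5, pp. 103–104] -/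
theorem exists_typeEleven_sqrtNegEleven_det [IsCyclotomicExtension {44} ℚ K] [IsCMField K]
    (hζ : IsPrimitiveRoot ζ 44) (Φ : CMType K)
    (hbal : 2 * (SΦ[Φ, ζ] ∩ ({7, 13, 17, 19, 21, 29, 35, 39, 41, 43} : Finset (ZMod 44))).card = (SΦ[Φ, ζ]).card)
    {𝔣₀ : Ideal (𝓞 (maximalRealSubfield K))}
    (h𝔣₀ : 𝔣₀.map (algebraMap (𝓞 (maximalRealSubfield K)) (𝓞 K)) =
      Ideal.span {hζ.toInteger ^ 41 * (1 - hζ.toInteger ^ 4) * (1 - hζ.toInteger ^ 2)}) :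
    ∃ ζ' : K, IsCMField.complexConj K ζ' = -ζ' ∧ (∀ φ : Φ.1, 0 < (φ.1 ζ').im) ∧
      CMTypeLattice.IsOfType (1 : (FractionalIdeal (𝓞 K)⁰ K)ˣ) ζ' 𝔣₀ ∧
      ∀ (x : Fin 10 → K), (∀ i, x i = (ζ + ζ⁻¹) ^ (i : ℕ)) → ∀ a : Matrix (Fin 10) (Fin 10) ℚ,
        (∀ i j, a i j = Algebra.trace ℚ K (ζ' * x i * IsCMField.complexConj K ((1 + 2 * (ζ ^ 4 + ζ ^ 12 + ζ ^ 16 + ζ ^ 20 + ζ ^ 36)) * x j))) →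
        a.det = -1814078464 := by
  obtain ⟨ζ', h1, h2, h3⟩ := exists_type_fortyFour_sqrt_neg_eleven hζ Φ hbal h𝔣₀
  exact ⟨ζ', h1, h2, h3, fun x hx a ha => det_realPart_typeEleven_sqrtNegEleven hζ h𝔣₀ h1 h3 hx ha⟩

/-! The CLASS of `-1814078464` — `[−1]·[(2⁵·11³)²] = splitDiscriminantClass 5 11`, SPLIT — is the SAME rational number as at
level `33` and is already a tree theorem: `Summit.HodgeConjecture.Ring2WeilCoverage.WeilGramLevel33Types.mk0_det_typeEleven_sqrtNegEleven`
(part 126; not restated here): the type-`𝔮₁₁` polarised Weil-type `ℤ[ζ₄₄]`-CM tenfolds lie on the SPLIT row W10.11.1. -/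

/-! ### §2 Type `𝔮₂`: invariance, census form, class `[−2]` NON-SPLIT -/

/-- **For EVERY skew `ζ′` of type 𝔮₂ (degree `32`) on `ℤ[ζ_44]` (`IsOfType 1 ζ′ 𝔣₀`, `𝔬𝔣₀ = (π)`, `(𝔬𝔣₀)² = (2)`, degree `32`; `ζ′ = u·πξ`,
`u` a real unit of norm `1` by THEOREM L (i) at `44`) the Gram determinant of `(E_ζ′, s₁₁)` in the frame `θ^i` is `-5277319168`**
(they exist on every `ℚ(√−11)`-balanced `Φ`, part 52a): the NON-SPLIT component **`(5, ℚ(√−11), 2)`**, `T = {2, 11}` (census row W10.11.2); `(−1)⁵ det a > 0`, the right sign for Weil signature `(5,5)` [vG94 5.2 (4)].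
research route conditional on HC_CM; not a corollary; Q11.4-sentence-2 already refuted in dim ≥ 3. [cite: vanGeemen1994HodgeAV, Lemma 5.2 (3)–(4) and (5.4.1)] [cite: Shimura1998, §14.3 Prop. 4–5, pp. 103–104] -/
theorem det_realPart_typeTwo_sqrtNegEleven [IsCyclotomicExtension {44} ℚ K] [IsCMField K]
    (hζ : IsPrimitiveRoot ζ 44) {𝔣₀ : Ideal (𝓞 (maximalRealSubfield K))}
    (h𝔣₀ : 𝔣₀.map (algebraMap (𝓞 (maximalRealSubfield K)) (𝓞 K)) = Ideal.span {hζ.toInteger ^ 38 * (1 - hζ.toInteger ^ 11) * (1 - hζ.toInteger ^ 1)})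
    {ζ' : K} (hζ' : IsCMField.complexConj K ζ' = -ζ')
    (hT : CMTypeLattice.IsOfType (1 : (FractionalIdeal (𝓞 K)⁰ K)ˣ) ζ' 𝔣₀)
    {x : Fin 10 → K} (hx : ∀ i, x i = (ζ + ζ⁻¹) ^ (i : ℕ)) {a : Matrix (Fin 10) (Fin 10) ℚ}
    (ha : ∀ i j, a i j = Algebra.trace ℚ K (ζ' * x i * IsCMField.complexConj K ((1 + 2 * (ζ ^ 4 + ζ ^ 12 + ζ ^ 16 + ζ ^ 20 + ζ ^ 36)) * x j))) :
    a.det = -5277319168 := by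
  obtain ⟨ωb, hωb⟩ := exists_basis_thetaPow hζ
  have hx' : ∀ i, x i = (ωb i : K) := fun i => (hx i).trans (hωb i).symm
  have hg : Nat.totient 44 = 2 * (9 + 1) := by decide
  have hsk : IsCMField.complexConj K (ζ ^ 38 * (1 - ζ ^ 11) * (1 - ζ) * (ζ ^ 9 * (aeval ζ (derivative (cyclotomic 44 ℚ)))⁻¹)) =
      -(ζ ^ 38 * (1 - ζ ^ 11) * (1 - ζ) * (ζ ^ 9 * (aeval ζ (derivative (cyclotomic 44 ℚ)))⁻¹)) := by
    simpa only [pow_one] using complexConj_gen_mul_xi hζ hg adm_fortyFourB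
  have h0 : (ζ ^ 38 * (1 - ζ ^ 11) * (1 - ζ) * (ζ ^ 9 * (aeval ζ (derivative (cyclotomic 44 ℚ)))⁻¹)) ≠ 0 :=
    mul_ne_zero (by simpa only [pow_one] using gen_ne_zero hζ adm_fortyFourB) (xi_ne_zero hζ 9)
  have hT₀ : CMTypeLattice.IsOfType (1 : (FractionalIdeal (𝓞 K)⁰ K)ˣ) (ζ ^ 38 * (1 - ζ ^ 11) * (1 - ζ) * (ζ ^ 9 * (aeval ζ (derivative (cyclotomic 44 ℚ)))⁻¹)) 𝔣₀ := by
    simpa only [pow_one] using isOfType_one_gen_mul_xi hζ 9 ((11, 1, 38) : ℕ × ℕ × ℕ) h𝔣₀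
  rw [det_realPart_eq_of_isOfType ωb (complexConj_sqrtNegEleven hζ) hx' (norm_realUnits_pos_fortyFour hζ)
    hsk h0 hζ' hT₀ hT (fun i j => rfl) ha]
  exact det_realPart_piTwo_sqrtNegEleven hζ hx (fun i j => rfl)

open scoped Classical in
/-- **CENSUS FORM** (part 52a's existence + the determinant): for every CM type `Φ` of `ℚ(ζ_44)` balanced for `N_K = {7, 13, 17, 19, 21, 29, 35, 39, 41, 43}` (Weil signature `(5,5)`
for `K_d = ℚ(√−11)`) and the type `𝔣₀` above, `ℂ^Φ/Φ(ℤ[ζ_44])` carries a `Φ`-positive divisor of type `(K; Φ; 𝔣₀)`, and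
EVERY such divisor `X_ζ′` has van Geemen Gram determinant `-5277319168` in the real frame `θ^i`: the NON-SPLIT component **`(5, ℚ(√−11), 2)`**, `T = {2, 11}` (census row W10.11.2).
research route conditional on HC_CM; not a corollary; Q11.4-sentence-2 already refuted in dim ≥ 3. [cite: vanGeemen1994HodgeAV, Lemma 5.2 (3)–(4) and (5.4.1)] [cite: Shimura1998, §14.3 Prop. 4–5, pp. 103–104] -/
theorem exists_typeTwo_sqrtNegEleven_det [IsCyclotomicExtension {44} ℚ K] [IsCMField K]
    (hζ : IsPrimitiveRoot ζ 44) (Φ : CMType K)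
    (hbal : 2 * (SΦ[Φ, ζ] ∩ ({7, 13, 17, 19, 21, 29, 35, 39, 41, 43} : Finset (ZMod 44))).card = (SΦ[Φ, ζ]).card)
    {𝔣₀ : Ideal (𝓞 (maximalRealSubfield K))}
    (h𝔣₀ : 𝔣₀.map (algebraMap (𝓞 (maximalRealSubfield K)) (𝓞 K)) =
      Ideal.span {hζ.toInteger ^ 38 * (1 - hζ.toInteger ^ 11) * (1 - hζ.toInteger ^ 1)}) :
    ∃ ζ' : K, IsCMField.complexConj K ζ' = -ζ' ∧ (∀ φ : Φ.1, 0 < (φ.1 ζ').im) ∧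
      CMTypeLattice.IsOfType (1 : (FractionalIdeal (𝓞 K)⁰ K)ˣ) ζ' 𝔣₀ ∧
      ∀ (x : Fin 10 → K), (∀ i, x i = (ζ + ζ⁻¹) ^ (i : ℕ)) → ∀ a : Matrix (Fin 10) (Fin 10) ℚ,
        (∀ i j, a i j = Algebra.trace ℚ K (ζ' * x i * IsCMField.complexConj K ((1 + 2 * (ζ ^ 4 + ζ ^ 12 + ζ ^ 16 + ζ ^ 20 + ζ ^ 36)) * x j))) →
        a.det = -5277319168 := by
  obtain ⟨ζ', h1, h2, h3⟩ := exists_type_fortyFourB_sqrt_neg_eleven hζ Φ hbal h𝔣₀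
  exact ⟨ζ', h1, h2, h3, fun x hx a ha => det_realPart_typeTwo_sqrtNegEleven hζ h𝔣₀ h1 h3 hx ha⟩

/-! The CLASS of `-5277319168` — `[−2] ≠ splitDiscriminantClass 5 11` (`2 ∉ Nm(ℚ(√−11)ˣ)`, ring2-b02's
`two_not_mem_norm_eleven`) — is the SAME rational number as for the surd type `(5 + √33)/2` at level `33` and is already a tree
theorem: `Summit.HodgeConjecture.Ring2WeilCoverage.WeilGramLevel33Types.mk0_det_surdTwo_sqrtNegEleven` (part 126; not restated here):
the type-`𝔮₂` (degree `32`) polarised Weil-type `ℤ[ζ₄₄]`-CM tenfolds lie on the NON-SPLIT component `(5, ℚ(√−11), 2)`, `T = {2, 11}`. -/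

/-! ### §3 Type `(2 + √11)`: invariance, census form, class `[−7]` NON-SPLIT -/

/-- **For EVERY skew `ζ′` of type `(2 + √11)` (degree `7⁵ = 16807`) on `ℤ[ζ_44]` (`IsOfType 1 ζ′ 𝔣₀`, `𝔬𝔣₀ = (ϖ)`, `𝔬𝔣₀·(2 − θ₁₁) = (7)`, degree `7⁵ = 16807`; `ζ′ = u·ϖξ`,
`u` a real unit of norm `1` by THEOREM L (i) at `44`) the Gram determinant of `(E_ζ′, s₁₁)` in the frame `θ^i` is `-2771746976768`**
(they exist on every `ℚ(√−11)`-balanced `Φ`, part 54e): the NON-SPLIT component **`(5, ℚ(√−11), 7)`**, `T = {7, 11}` (census row W10.11.7); `(−1)⁵ det a > 0`, the right sign for Weil signature `(5,5)` [vG94 5.2 (4)].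
research route conditional on HC_CM; not a corollary; Q11.4-sentence-2 already refuted in dim ≥ 3. [cite: vanGeemen1994HodgeAV, Lemma 5.2 (3)–(4) and (5.4.1)] [cite: Shimura1998, §14.3 Prop. 4–5, pp. 103–104] -/
theorem det_realPart_surdSeven_sqrtNegEleven [IsCyclotomicExtension {44} ℚ K] [IsCMField K]
    (hζ : IsPrimitiveRoot ζ 44) {𝔣₀ : Ideal (𝓞 (maximalRealSubfield K))}
    (h𝔣₀ : 𝔣₀.map (algebraMap (𝓞 (maximalRealSubfield K)) (𝓞 K)) =
      Ideal.span {(2 + hζ.toInteger ^ 11 * (1 + 2 * (hζ.toInteger ^ 4 + hζ.toInteger ^ 12 + hζ.toInteger ^ 16 +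
      hζ.toInteger ^ 20 + hζ.toInteger ^ 36)) : 𝓞 K)})
    {ζ' : K} (hζ' : IsCMField.complexConj K ζ' = -ζ')
    (hT : CMTypeLattice.IsOfType (1 : (FractionalIdeal (𝓞 K)⁰ K)ˣ) ζ' 𝔣₀)
    {x : Fin 10 → K} (hx : ∀ i, x i = (ζ + ζ⁻¹) ^ (i : ℕ)) {a : Matrix (Fin 10) (Fin 10) ℚ}
    (ha : ∀ i j, a i j = Algebra.trace ℚ K (ζ' * x i * IsCMField.complexConj K ((1 + 2 * (ζ ^ 4 + ζ ^ 12 + ζ ^ 16 + ζ ^ 20 + ζ ^ 36)) * x j))) :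
    a.det = -2771746976768 := by
  obtain ⟨ωb, hωb⟩ := exists_basis_thetaPow hζ
  have hx' : ∀ i, x i = (ωb i : K) := fun i => (hx i).trans (hωb i).symm
  obtain ⟨-, hreal, hϖ0⟩ := signSet_fortyFour_seven hζ
  have hP := coe_surd_fortyFour hζ
  have hsk := complexConj_mul_xi hζ (by decide : Nat.totient 44 = 2 * (9 + 1)) hreal
  have h0 := mul_ne_zero hϖ0 (xi_ne_zero hζ 9)
  have hT₀ := isOfType_one_mul_xi hζ 9 hP h𝔣₀
  rw [det_realPart_eq_of_isOfType ωb (complexConj_sqrtNegEleven hζ) hx' (norm_realUnits_pos_fortyFour hζ)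
    hsk h0 hζ' hT₀ hT (fun i j => rfl) ha]
  exact det_realPart_varpiSeven_sqrtNegEleven hζ hx (fun i j => rfl)

open scoped Classical in
/-- **CENSUS FORM** (part 54e's existence + the determinant): for every CM type `Φ` of `ℚ(ζ_44)` balanced for `N_K = {7, 13, 17, 19, 21, 29, 35, 39, 41, 43}` (Weil signature `(5,5)`
for `K_d = ℚ(√−11)`) and the type `𝔣₀` above, `ℂ^Φ/Φ(ℤ[ζ_44])` carries a `Φ`-positive divisor of type `(K; Φ; 𝔣₀)`, and
EVERY such divisor `X_ζ′` has van Geemen Gram determinant `-2771746976768` in the real frame `θ^i`: the NON-SPLIT component **`(5, ℚ(√−11), 7)`**, `T = {7, 11}` (census row W10.11.7).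
research route conditional on HC_CM; not a corollary; Q11.4-sentence-2 already refuted in dim ≥ 3. [cite: vanGeemen1994HodgeAV, Lemma 5.2 (3)–(4) and (5.4.1)] [cite: Shimura1998, §14.3 Prop. 4–5, pp. 103–104] -/
theorem exists_surdSeven_sqrtNegEleven_det [IsCyclotomicExtension {44} ℚ K] [IsCMField K]
    (hζ : IsPrimitiveRoot ζ 44) (Φ : CMType K)
    (hbal : 2 * (SΦ[Φ, ζ] ∩ ({7, 13, 17, 19, 21, 29, 35, 39, 41, 43} : Finset (ZMod 44))).card = (SΦ[Φ, ζ]).card)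
    {𝔣₀ : Ideal (𝓞 (maximalRealSubfield K))}
    (h𝔣₀ : 𝔣₀.map (algebraMap (𝓞 (maximalRealSubfield K)) (𝓞 K)) =
      Ideal.span {(2 + hζ.toInteger ^ 11 * (1 + 2 * (hζ.toInteger ^ 4 + hζ.toInteger ^ 12 + hζ.toInteger ^ 16 +
      hζ.toInteger ^ 20 + hζ.toInteger ^ 36)) : 𝓞 K)}) :
    ∃ ζ' : K, IsCMField.complexConj K ζ' = -ζ' ∧ (∀ φ : Φ.1, 0 < (φ.1 ζ').im) ∧
      CMTypeLattice.IsOfType (1 : (FractionalIdeal (𝓞 K)⁰ K)ˣ) ζ' 𝔣₀ ∧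
      ∀ (x : Fin 10 → K), (∀ i, x i = (ζ + ζ⁻¹) ^ (i : ℕ)) → ∀ a : Matrix (Fin 10) (Fin 10) ℚ,
        (∀ i j, a i j = Algebra.trace ℚ K (ζ' * x i * IsCMField.complexConj K ((1 + 2 * (ζ ^ 4 + ζ ^ 12 + ζ ^ 16 + ζ ^ 20 + ζ ^ 36)) * x j))) →
        a.det = -2771746976768 := by
  obtain ⟨ζ', h1, h2, h3⟩ := exists_type_fortyFour_seven_sqrt_neg_eleven hζ Φ hbal h𝔣₀
  exact ⟨ζ', h1, h2, h3, fun x hx a ha => det_realPart_surdSeven_sqrtNegEleven hζ h𝔣₀ h1 h3 hx ha⟩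

/-- **`[-2771746976768] = [−7] ≠ splitDiscriminantClass 5 11` in `ℚˣ/Nm(ℚ(√−11)ˣ)`** (`7/2771746976768 = (0)² + 11·((1 / 2087008))² ∈ Nm`; `7 ∉ Nm(ℚ(√−11)ˣ)` is ring2-b02's `seven_not_mem_norm_eleven`):
the type-`(2 + √11)` (degree `16807`) polarised Weil-type `ℤ[ζ₄₄]`-CM tenfolds lie on the NON-SPLIT component **`(5, ℚ(√−11), 7)`**, `T = {7, 11}` (census row W10.11.7).
research route conditional on HC_CM; not a corollary; Q11.4-sentence-2 already refuted in dim ≥ 3. [cite: vanGeemen1994HodgeAV, 5.4 and (5.4.1)] [cite: Serre1973, Ch. III §1] -/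
theorem mk0_det_surdSeven_sqrtNegEleven :
    (QuotientGroup.mk (Units.mk0 (-2771746976768 : ℚ) (by norm_num)) : weilNormResidueGroup 11) =
        QuotientGroup.mk (Units.mk0 (-7 : ℚ) (by norm_num)) ∧
      (QuotientGroup.mk (Units.mk0 (-7 : ℚ) (by norm_num)) : weilNormResidueGroup 11) ≠
        splitDiscriminantClass 5 11 := by
  constructor
  · rw [QuotientGroup.eq]
    have e : (Units.mk0 (-2771746976768 : ℚ) (by norm_num))⁻¹ * Units.mk0 (-7 : ℚ) (by norm_num) =
        Units.mk0 (((1 / 395963853824)) : ℚ) (by norm_num) := Units.ext (by norm_num)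
    rw [e]
    exact mem_normUnitsSubgroup_of_sq_add_mul_sq _ (0 : ℚ) ((1 / 2087008) : ℚ) (by norm_num)
  · exact mk_neg_ne_split_of_odd (by decide) _ seven_not_mem_norm_eleven

end Summit.HodgeConjecture.Ring2WeilCoverage.WeilGramLevel44Types

end
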